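import Mathlib
import HarnessLib
import Summits.NavierStokesRegularity.NavierStokesRegularity.Theorems.PoloidalWindowDoorLrcModEntireMorseLevelRays
import Summits.NavierStokesRegularity.NavierStokesRegularity.Theorems.PoloidalWindowDoorLrcModEntireMorseLevelRadial
import Summits.NavierStokesRegularity.NavierStokesRegularity.Theorems.PoloidalWindowDoorLrcModEntireMorseLevelCutoff
import Summits.NavierStokesRegularity.NavierStokesRegularity.Theorems.PoloidalWindowDoorLrcModEntireMorseLevelGeometry

/-!
# Route `PoloidalWindowDoor`, crux `PoloidalWindowRigidity` (stmt-19708) / item `LrcModEntire` (stmt-20428), ideator line `thread_axis`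
# (ns-idea-8) — STUB S7′-M `stub_morseLevelPackage` PROVED: the parametrised Morse package with a covering curve

Seat ns-poloidal-K2-p2 g10 (LEAD-lineage on 19708; file `--supports`).  Statement = `Cruxes/PoloidalWindowRigidity/Lines/thread_axis.lean`
v10, `stub_morseLevelPackage` (l. 570–587) VERBATIM.  For `g : ℝ³ → ℝ` of class `C²` with a global extremum of `|g|` at `0`
(`g 0 ≠ 0`, `|g| ≤ |g 0|`) and a non-degenerate horizontal Hessian there, near-top horizontal level circles are packaged: an open
set `U ∋` points arbitrarily close to `0`, and for each `p ∈ U` a `C¹` map `H : ℝ³ → ℝ²` whose zero set is EXACTLY the level circle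
`{y | y₂ = p₂, g y = g p}` around the vertical axis, bounded, regular (`dH` onto), equal to the planar map `(g − g p, y₂ − p₂)` on a
neighbourhood `{χ ≠ 0}` of it, with `∇ₕg ≠ 0` on it, and COVERED by a differentiable horizontal curve `σ` tangent to the `g`-levels.

Construction (case `g 0 > 0`, a global maximum; `g 0 < 0` by `…MorseLevelCutoff.package_of_neg` applied to `−g`):
`…MorseLevelRays.exists_concavity_ball` (horizontal concavity on `B̄(0,δ)`), `…MorseLevelGeometry.exists_max_horizontalAnnulus_lt` + uniform
continuity on `B̄(0,δ)` (every slice `y₂ = p₂`, `‖p‖ < ρ`, has `g < g p` at horizontal distances `[δ₁/4, δ₁]` from the axis point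
`o = (0,0,p₂)`, `δ₁ = δ/2`), `U = {‖p‖ < ρ, g p < g o}`, the radial root and covering curve `σ θ = o + rad θ•(cos θ, sin θ, 0)` of
`…MorseLevelRadial.exists_levelCurve` (`rad θ < δ₁/4`), and `H y = (χ₀(y) g(y) + (1 − χ₀(y))(g p − 1) − g p, y₂ − p₂)` with `χ₀` a smooth bump
`= 1` on `B̄(o, δ₁/2)`, supported in `B(o, δ₁)` (transition shell inside `{g < g p}` on the slice, so no spurious zeros), `χ` a bump `= 1` on
`B̄(o, δ₁/4)` supported in `B(o, δ₁/2)`.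

WHAT THIS IS NOT: not a claim about Navier–Stokes; pure calculus for the Morse branch of the thick column (bears_on LADDER-NS N0 via crux 19708 /
item 20428, thread_axis S7′-M). [folklore]
-/

noncomputable section

-- the summit and its single sub-problem share the name (CONVENTIONS §1), as in every Theorems file
set_option linter.dupNamespace false

namespace Summit.NavierStokesRegularity.NavierStokesRegularity.Theorems.PoloidalWindowDoorLrcModEntireMorseLevelPackage

open Set Function Filter Topology Metric
open Summit.NavierStokesRegularity.NavierStokesRegularity.Theorems.PoloidalWindowDoorLrcModEntireMorseLevelRays
open Summit.NavierStokesRegularity.NavierStokesRegularity.Theorems.PoloidalWindowDoorLrcModEntireMorseLevelRadial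
open Summit.NavierStokesRegularity.NavierStokesRegularity.Theorems.PoloidalWindowDoorLrcModEntireMorseLevelCutoff
open Summit.NavierStokesRegularity.NavierStokesRegularity.Theorems.PoloidalWindowDoorLrcModEntireMorseLevelGeometry

/-- **The Morse level package at a global MAXIMUM.**  `g ∈ C²`, `g ≤ g 0`, horizontal Hessian at `0` without kernel directions
(`D²g(0)(e,e) ≠ 0` for horizontal `e ≠ 0`) ⇒ the conclusion of `stub_morseLevelPackage` for `g`. [folklore] -/
theorem morseLevelPackage_of_max (g : EuclideanSpace ℝ (Fin 3) → ℝ) (hg : ContDiff ℝ 2 g) (hmax : ∀ x, g x ≤ g 0)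
    (hH : ∀ e : EuclideanSpace ℝ (Fin 3), e ≠ 0 → e 2 = 0 → fderiv ℝ (fun x => fderiv ℝ g x e) 0 e ≠ 0) :
    ∃ U : Set (EuclideanSpace ℝ (Fin 3)), IsOpen U ∧ U.Nonempty ∧ ∀ p ∈ U,
      ∃ (H : EuclideanSpace ℝ (Fin 3) → (Fin 2 → ℝ)) (χ : EuclideanSpace ℝ (Fin 3) → ℝ) (R : ℝ),
        ContDiff ℝ 1 H ∧ ContDiff ℝ 1 χ ∧ H p = 0 ∧
        (∀ y, H y = 0 → ‖y‖ ≤ R) ∧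
        (∀ y, H y = 0 → Function.Surjective (fderiv ℝ H y)) ∧
        (∀ y, H y = 0 → χ y = 1) ∧
        (∀ y, χ y ≠ 0 → H y = ![g y - g p, y 2 - p 2]) ∧
        (∀ y, χ y ≠ 0 → ∀ w, fderiv ℝ H y w = ![fderiv ℝ g y w, w 2]) ∧
        (∀ y, H y = 0 → fderiv ℝ g y (EuclideanSpace.single 0 1) ≠ 0 ∨
          fderiv ℝ g y (EuclideanSpace.single 1 1) ≠ 0) ∧
        ∃ σ σ' : ℝ → EuclideanSpace ℝ (Fin 3),
          (∀ θ, HasDerivAt σ (σ' θ) θ) ∧ (∀ θ, σ' θ 2 = 0) ∧ (∀ θ, fderiv ℝ g (σ θ) (σ' θ) = 0) ∧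
          (∀ θ, H (σ θ) = 0) ∧ (∀ y, H y = 0 → ∃ θ, σ θ = y) := by
  have hgd : Differentiable ℝ g := hg.differentiable two_ne_zero
  have hgc : Continuous g := hg.continuous
  have hcrit : fderiv ℝ g 0 = 0 := fderiv_eq_zero_of_max hmax
  -- (1) the horizontal Hessian at `0` is negative definite
  have hneg0 : ∀ e : EuclideanSpace ℝ (Fin 3), e 2 = 0 → ‖e‖ = 1 → fderiv ℝ (fderiv ℝ g) 0 e e < 0 := by
    intro e he2 he1
    have hne : e ≠ 0 := by
      intro h; rw [h, norm_zero] at he1; exact zero_ne_one he1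
    have h2 : fderiv ℝ (fderiv ℝ g) 0 e e ≠ 0 := by rw [← fderiv_fderiv_apply_const hg]; exact hH e hne he2
    exact lt_of_le_of_ne (fderiv2_apply_nonpos_of_max hg hmax e) h2
  -- (2) the concavity ball
  obtain ⟨δ, hδ, hconc⟩ := exists_concavity_ball hg hneg0
  set δ₁ : ℝ := δ / 2 with hδ₁
  have hδ₁ : 0 < δ₁ := by positivity
  -- directions
  set u : ℝ → EuclideanSpace ℝ (Fin 3) := fun θ => Real.cos θ • EuclideanSpace.single 0 1 + Real.sin θ • EuclideanSpace.single 1 1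
    with hu
  -- (3) the annulus maximum and the gap `η`
  obtain ⟨x₀, hx₀, hann⟩ := exists_max_horizontalAnnulus_lt hg hcrit (by positivity : 0 < δ₁ / 4) (by linarith : δ₁ / 4 ≤ δ₁)
    (by linarith : δ₁ ≤ δ) hconc
  set η : ℝ := g 0 - g x₀ with hη
  have hη0 : 0 < η := by rw [hη]; linarith
  -- (4) uniform continuity of `g` on the concavity ball
  obtain ⟨ρ₁, hρ₁, hUC⟩ := Metric.uniformContinuousOn_iff.1
    ((isCompact_closedBall (0 : EuclideanSpace ℝ (Fin 3)) δ).uniformContinuousOn_of_continuous hgc.continuousOn) (η / 3)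
    (by positivity)
  set ρ : ℝ := min ρ₁ (δ₁ / 4) with hρ
  have hρ0 : 0 < ρ := lt_min hρ₁ (by positivity)
  have hρ1 : ρ ≤ ρ₁ := min_le_left _ _
  have hρ4 : ρ ≤ δ₁ / 4 := min_le_right _ _
  -- (5) the open set
  set e2 : EuclideanSpace ℝ (Fin 3) := EuclideanSpace.single 2 1 with he2
  set U : Set (EuclideanSpace ℝ (Fin 3)) := {p | ‖p‖ < ρ ∧ g p < g (p 2 • e2)} with hU
  have hvc : Continuous fun p : EuclideanSpace ℝ (Fin 3) => p 2 • e2 :=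
    (EuclideanSpace.proj (2 : Fin 3)).continuous.smul continuous_const
  have hUo : IsOpen U := (isOpen_lt continuous_norm continuous_const).inter (isOpen_lt hgc (hgc.comp hvc))
  have hUne : U.Nonempty := by
    refine ⟨(ρ / 2) • EuclideanSpace.single 0 1, ?_, ?_⟩
    · show ‖(ρ / 2) • EuclideanSpace.single (0 : Fin 3) (1 : ℝ)‖ < ρ
      rw [norm_smul, PiLp.norm_single, norm_one, mul_one, Real.norm_of_nonneg (by positivity)]
      linarith
    · show g ((ρ / 2) • EuclideanSpace.single 0 1) < g ((((ρ / 2) • EuclideanSpace.single (0 : Fin 3) (1 : ℝ) :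
          EuclideanSpace ℝ (Fin 3)) 2) • e2)
      have h0 : (((ρ / 2) • EuclideanSpace.single (0 : Fin 3) (1 : ℝ) : EuclideanSpace ℝ (Fin 3)) 2) • e2 = 0 := by simp [he2]
      rw [h0]
      exact ray_lt_of_concave hg hcrit hconc (by simp) (by rw [PiLp.norm_single, norm_one]) (by positivity) (by linarith)
  refine ⟨U, hUo, hUne, fun p hp => ?_⟩
  -- (6) a point of `U`: the slice `y₂ = h`, the axis point `o`, the level `c`
  obtain ⟨hpρ, hpg⟩ := hp
  set h : ℝ := p 2 with hh
  set o : EuclideanSpace ℝ (Fin 3) := h • e2 with ho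
  set c : ℝ := g p with hc
  have ho2 : o 2 = h := by simp [ho, he2]
  have hno : ‖o‖ = |h| := by rw [ho, he2]; exact norm_vaxis h
  have hnoρ : ‖o‖ < ρ := by
    rw [hno, hh]; exact (abs_apply_le_norm p 2).trans_lt hpρ
  have hc0 : c < g o := hpg
  have hp0 : (0 : EuclideanSpace ℝ (Fin 3)) ∈ closedBall (0 : EuclideanSpace ℝ (Fin 3)) δ := mem_closedBall_self hδ.le
  have hpball : p ∈ closedBall (0 : EuclideanSpace ℝ (Fin 3)) δ := mem_closedBall_zero_iff.2 (by linarith)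
  have hcg0 : g 0 - η / 3 < c := by
    have := hUC p hpball 0 hp0 (by rw [dist_zero_right]; linarith)
    rw [Real.dist_eq] at this
    have := (abs_lt.1 this).1
    rw [hc]; linarith
  -- rays from `o` of length `≤ δ₁` stay in the concavity ball
  have hball : ∀ θ, ∀ t ∈ Icc 0 δ₁, o + t • u θ ∈ closedBall (0 : EuclideanSpace ℝ (Fin 3)) δ := fun θ t ht =>
    mem_closedBall_axis_add (norm_dir hu θ) ht.1 (by linarith [ht.2])
  -- the annulus estimate on the slice: `g(o + t•u θ) < c` for `δ₁/4 ≤ t ≤ δ₁`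
  have hann' : ∀ θ t, δ₁ / 4 ≤ t → t ≤ δ₁ → g (o + t • u θ) < c := by
    intro θ t ht1 ht2
    have ht0 : 0 ≤ t := le_trans (by positivity) ht1
    have hx : g (t • u θ) ≤ g x₀ := hann (t • u θ) (by simp [dir_apply_two hu θ])
      (by rw [norm_smul, norm_dir hu θ, mul_one, Real.norm_of_nonneg ht0]; exact ht1)
      (by rw [norm_smul, norm_dir hu θ, mul_one, Real.norm_of_nonneg ht0]; exact ht2)
    have hm1 : o + t • u θ ∈ closedBall (0 : EuclideanSpace ℝ (Fin 3)) δ := hball θ t ⟨ht0, ht2⟩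
    have hm2 : t • u θ ∈ closedBall (0 : EuclideanSpace ℝ (Fin 3)) δ := by
      rw [mem_closedBall_zero_iff, norm_smul, norm_dir hu θ, mul_one, Real.norm_of_nonneg ht0]; linarith
    have hd : dist (o + t • u θ) (t • u θ) < ρ₁ := by
      rw [dist_eq_norm, add_sub_cancel_right]; linarith
    have := hUC _ hm1 _ hm2 hd
    rw [Real.dist_eq] at this
    have := (abs_lt.1 this).2
    linarith
  have hcL : ∀ θ, g (o + δ₁ • u θ) < c := fun θ => hann' θ δ₁ (by linarith) le_rfl
  -- (7) the radial root and the covering curve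
  obtain ⟨rad, σ, σ', hradI, hσdef, hσd, hσ2, hσc, htan, hreg, huniq, hbefore, -⟩ :=
    exists_levelCurve hg hu hδ₁ hconc hball hc0 hcL
  have hrad4 : ∀ θ, rad θ < δ₁ / 4 := by
    intro θ
    by_contra hle
    rw [not_lt] at hle
    have hq : δ₁ / 4 ∈ Icc 0 δ₁ := ⟨by positivity, by linarith⟩
    rcases eq_or_lt_of_le hle with he | hlt
    · have h1 := hσc θ
      rw [hσdef θ, ← he] at h1
      have h2 := hann' θ (δ₁ / 4) le_rfl (by linarith)
      linarith
    · have h1 := hbefore θ (δ₁ / 4) hq hlt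
      have h2 := hann' θ (δ₁ / 4) le_rfl (by linarith)
      linarith
  have hdistσ : ∀ θ, dist (σ θ) o = rad θ := fun θ => by
    rw [hσdef θ]; exact dist_axis_add (norm_dir hu θ) (hradI θ).1.le
  have hσ_two : ∀ θ, σ θ 2 = h := fun θ => by
    rw [hσdef θ]
    simp [ho2, dir_apply_two hu θ]
  -- (8) the cut-offs
  let χ₀ : ContDiffBump o := ⟨δ₁ / 2, δ₁, by positivity, by linarith⟩
  let χb : ContDiffBump o := ⟨δ₁ / 4, δ₁ / 2, by positivity, by linarith⟩
  have hχ₀one : ∀ y, dist y o ≤ δ₁ / 2 → χ₀ y = 1 := fun y hy => χ₀.one_of_mem_closedBall (mem_closedBall.2 hy)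
  have hχ₀zero : ∀ y, δ₁ ≤ dist y o → χ₀ y = 0 := fun y hy => χ₀.zero_of_le_dist hy
  have hχbone : ∀ y, dist y o ≤ δ₁ / 4 → χb y = 1 := fun y hy => χb.one_of_mem_closedBall (mem_closedBall.2 hy)
  have hχbzero : ∀ y, δ₁ / 2 ≤ dist y o → χb y = 0 := fun y hy => χb.zero_of_le_dist hy
  set gt : EuclideanSpace ℝ (Fin 3) → ℝ := fun y => χ₀ y * g y + (1 - χ₀ y) * (c - 1) with hgt
  set Hf : EuclideanSpace ℝ (Fin 3) → (Fin 2 → ℝ) := fun y => ![gt y - c, y 2 - h] with hHf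
  have hgt_of_one : ∀ y, χ₀ y = 1 → gt y = g y := fun y hy => by rw [hgt]; simp only [hy]; ring
  -- where `χb ≠ 0`, and near every point of `B(o, δ₁/2)`, `H` is the planar level map
  have hHf_planar : ∀ y, dist y o < δ₁ / 2 → Hf =ᶠ[𝓝 y] fun y => (![g y - c, y 2 - h] : Fin 2 → ℝ) := by
    intro y hy
    have hmem : ball o (δ₁ / 2) ∈ 𝓝 y := isOpen_ball.mem_nhds (mem_ball.2 hy)
    filter_upwards [hmem] with z hz
    rw [hHf]
    simp only [hgt_of_one z (hχ₀one z (mem_ball.1 hz).le)]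
  have hχb_dist : ∀ y, χb y ≠ 0 → dist y o < δ₁ / 2 := fun y hy => by
    by_contra hle; rw [not_lt] at hle; exact hy (hχbzero y hle)
  -- (9) the zero set of `H` is the level circle `{σ θ}`
  have hHσ : ∀ θ, Hf (σ θ) = 0 := by
    intro θ
    rw [hHf]
    simp only
    rw [vec2_eq_zero_iff, hgt_of_one (σ θ) (hχ₀one _ (by rw [hdistσ θ]; linarith [hrad4 θ])), hσc θ, hσ_two θ]
    exact ⟨sub_self _, sub_self _⟩
  have hzero : ∀ y, Hf y = 0 → ∃ θ, σ θ = y := by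
    intro y hy
    rw [hHf] at hy
    simp only at hy
    rw [vec2_eq_zero_iff] at hy
    obtain ⟨hy1, hy2⟩ := hy
    -- `y` lies in the support of `χ₀`
    have hdy : dist y o < δ₁ := by
      by_contra hle; rw [not_lt] at hle
      have : gt y = c - 1 := by rw [hgt]; simp only [hχ₀zero y hle]; ring
      linarith
    -- the horizontal vector `w = y − o`
    set w : EuclideanSpace ℝ (Fin 3) := y - o with hw
    have hw2 : w 2 = 0 := by
      rw [hw]
      have : (y - o) 2 = y 2 - o 2 := by simp
      rw [this, ho2]; linarith
    have hyw : y = o + w := by rw [hw]; abel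
    have hwn : ‖w‖ = dist y o := by rw [hw, dist_eq_norm]
    have hw0 : w ≠ 0 := by
      intro h0
      have hyo : y = o := by rw [hyw, h0, add_zero]
      have h1 : gt y = g o := by rw [hyo]; exact hgt_of_one o (hχ₀one o (by rw [dist_self]; positivity))
      linarith
    obtain ⟨θ, hθ⟩ := exists_angle_of_horizontal hw2 hw0
    have hwu : w = ‖w‖ • u θ := by rw [hu]; exact hθ
    set t : ℝ := ‖w‖ with ht
    have ht0 : 0 < t := norm_pos_iff.2 hw0
    have htδ : t < δ₁ := by rw [hwn]; exact hdy
    have hyt : y = o + t • u θ := by rw [hyw, hwu]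
    refine ⟨θ, ?_⟩
    by_cases hts : t ≤ δ₁ / 2
    · -- inside: `χ₀ = 1`, so `g y = c`, and `t` is the radial root
      have hgy : g y = c := by
        have := hgt_of_one y (hχ₀one y (by rw [← hwn]; exact hts))
        linarith
      have := huniq θ t ⟨ht0.le, htδ.le⟩ (by rw [← hyt]; exact hgy)
      rw [hσdef θ, ← this, hyt]
    · -- transition shell: `g y < c`, so `gt y < c`
      rw [not_le] at hts
      have hgy : g y < c := by rw [hyt]; exact hann' θ t (by linarith) htδ.le
      have h0 := χ₀.nonneg (x := y)
      have h1 := χ₀.le_one (x := y)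
      have hprod : χ₀ y * g y ≤ χ₀ y * c := mul_le_mul_of_nonneg_left hgy.le h0
      have : gt y < c := by
        rcases eq_or_lt_of_le h1 with h1' | h1'
        · rw [hgt]; simp only; rw [h1']; linarith
        · rw [hgt]; simp only; nlinarith
      linarith
  -- (10) the clauses
  have hHd : ContDiff ℝ 1 Hf := by
    rw [hHf]
    refine contDiff_vec2 (ContDiff.sub ?_ contDiff_const) (contDiff_apply_two.sub contDiff_const)
    rw [hgt]
    exact (χ₀.contDiff.mul (hg.of_le (by norm_num))).add ((contDiff_const.sub χ₀.contDiff).mul contDiff_const)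
  have hHp : Hf p = 0 := by
    have hdp : dist p o ≤ δ₁ / 4 := by
      rw [dist_eq_norm, ho, hh, he2]
      exact (norm_sub_vproj_le p).trans (by linarith)
    rw [hHf]
    simp only
    rw [vec2_eq_zero_iff, hgt_of_one p (hχ₀one p (by linarith)), hc, hh]
    exact ⟨sub_self _, sub_self _⟩
  refine ⟨Hf, χb, δ, hHd, χb.contDiff, hHp, fun y hy => ?_, fun y hy => ?_, fun y hy => ?_, fun y hy => ?_,
    fun y hy w => ?_, fun y hy => ?_, σ, σ', hσd, hσ2, htan, hHσ, hzero⟩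
  · -- bounded
    obtain ⟨θ, rfl⟩ := hzero y hy
    rw [hσdef θ]
    have := hball θ (rad θ) ⟨(hradI θ).1.le, (hradI θ).2.le⟩
    exact mem_closedBall_zero_iff.1 this
  · -- regular
    obtain ⟨θ, rfl⟩ := hzero _ hy
    have hd : dist (σ θ) o < δ₁ / 2 := by rw [hdistσ θ]; linarith [hrad4 θ]
    exact surjective_planar (fun w => fderiv_eq_planar_of_eventuallyEq (hgd _) (hHf_planar _ hd) w) (hreg θ)
  · -- `χ = 1` on the zero set
    obtain ⟨θ, rfl⟩ := hzero _ hy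
    exact hχbone _ (by rw [hdistσ θ]; linarith [hrad4 θ])
  · -- values where `χ ≠ 0`
    have hd := hχb_dist y hy
    rw [hHf]
    simp only
    rw [hgt_of_one y (hχ₀one y hd.le)]
  · -- derivative where `χ ≠ 0`
    exact fderiv_eq_planar_of_eventuallyEq (hgd _) (hHf_planar _ (hχb_dist y hy)) w
  · -- horizontal gradient on the zero set
    obtain ⟨θ, rfl⟩ := hzero _ hy
    exact hreg θ

/-- **STUB S7′-M (`stub_morseLevelPackage`) — the parametrised Morse package with a covering curve**, statement VERBATIM from
`Cruxes/PoloidalWindowRigidity/Lines/thread_axis.lean` v10 (l. 570–587): for `g ∈ C²(ℝ³)` with `g 0 ≠ 0`, `|g| ≤ |g 0|` and no horizontal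
kernel direction of the Hessian at `0`, there is a non-empty open set `U` such that every `p ∈ U` carries a `C¹` level map `H : ℝ³ → ℝ²`, a `C¹`
cut-off `χ` and a radius `R` with: `H p = 0`; the zero set of `H` is bounded by `R`, regular, inside `{χ = 1}`; on `{χ ≠ 0}` the map `H` IS
`y ↦ (g y − g p, y₂ − p₂)` with derivative `w ↦ (dg(y)w, w₂)`; `∇ₕg ≠ 0` on the zero set; and a differentiable horizontal curve `σ`, tangent
to the `g`-levels, runs inside the zero set and covers it.  (Case `g 0 > 0`: `morseLevelPackage_of_max`; case `g 0 < 0`: the same for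
`−g`, transported by `…MorseLevelCutoff.package_of_neg`.) [folklore] -/
theorem stub_morseLevelPackage :
    ∀ (g : EuclideanSpace ℝ (Fin 3) → ℝ), ContDiff ℝ 2 g → g 0 ≠ 0 → (∀ x, |g x| ≤ |g 0|) →
      (∀ e : EuclideanSpace ℝ (Fin 3), e ≠ 0 → e 2 = 0 →
        fderiv ℝ (fun x => fderiv ℝ g x e) 0 e ≠ 0) →
      ∃ U : Set (EuclideanSpace ℝ (Fin 3)), IsOpen U ∧ U.Nonempty ∧ ∀ p ∈ U,
        ∃ (H : EuclideanSpace ℝ (Fin 3) → (Fin 2 → ℝ)) (χ : EuclideanSpace ℝ (Fin 3) → ℝ) (R : ℝ),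
          ContDiff ℝ 1 H ∧ ContDiff ℝ 1 χ ∧ H p = 0 ∧
          (∀ y, H y = 0 → ‖y‖ ≤ R) ∧
          (∀ y, H y = 0 → Function.Surjective (fderiv ℝ H y)) ∧
          (∀ y, H y = 0 → χ y = 1) ∧
          (∀ y, χ y ≠ 0 → H y = ![g y - g p, y 2 - p 2]) ∧
          (∀ y, χ y ≠ 0 → ∀ w, fderiv ℝ H y w = ![fderiv ℝ g y w, w 2]) ∧
          (∀ y, H y = 0 → fderiv ℝ g y (EuclideanSpace.single 0 1) ≠ 0 ∨
            fderiv ℝ g y (EuclideanSpace.single 1 1) ≠ 0) ∧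
          ∃ σ σ' : ℝ → EuclideanSpace ℝ (Fin 3),
            (∀ θ, HasDerivAt σ (σ' θ) θ) ∧ (∀ θ, σ' θ 2 = 0) ∧ (∀ θ, fderiv ℝ g (σ θ) (σ' θ) = 0) ∧
            (∀ θ, H (σ θ) = 0) ∧ (∀ y, H y = 0 → ∃ θ, σ θ = y) := by
  intro g hg hg0 habs hH
  rcases lt_or_gt_of_ne hg0 with hneg | hpos
  · -- global minimum: apply the maximum case to `−g`
    have habs' : ∀ x, -g x ≤ -g 0 := fun x => by
      have h1 := habs x
      rw [abs_of_neg hneg] at h1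
      have h2 := neg_abs_le (g x)
      linarith
    have hH' : ∀ e : EuclideanSpace ℝ (Fin 3), e ≠ 0 → e 2 = 0 →
        fderiv ℝ (fun x => fderiv ℝ (fun z => -g z) x e) 0 e ≠ 0 := fun e he he2 => by
      rw [fderiv_fderiv_neg_apply]; exact neg_ne_zero.2 (hH e he he2)
    obtain ⟨U, hUo, hUne, hpack⟩ := morseLevelPackage_of_max (fun z => -g z) hg.neg habs' hH'
    refine ⟨U, hUo, hUne, fun p hp => ?_⟩
    obtain ⟨H', χ, R, h1, h2, h3, h4, h5, h6, h7, h8, h9, σ, σ', h10, h11, h12, h13, h14⟩ := hpack p hp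
    exact package_of_neg g p H' χ R h1 h2 h3 h4 h5 h6 h7 h8 h9 σ σ' h10 h11 h12 h13 h14
  · -- global maximum
    have hmax : ∀ x, g x ≤ g 0 := fun x => by
      have h1 := habs x
      rw [abs_of_pos hpos] at h1
      exact (le_abs_self _).trans h1
    exact morseLevelPackage_of_max g hg hmax hH

end Summit.NavierStokesRegularity.NavierStokesRegularity.Theorems.PoloidalWindowDoorLrcModEntireMorseLevelPackage

end
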